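import Summits.AtomisticToContinuum.Crystallization.Theorems.OverbindingBudgetAffineFarFieldCellSymm

/-!
# OverbindingBudget (2c) — part 27Vb-S(B): transport of moment data under affine isometries (lens-4 g93; r1659 S3 groundwork)

Support file, pure analysis on `ℝ³ = EuclideanSpace ℝ (Fin 3)`, no atlas (file 2 of 2 of part 27Vb-S; file 1 is
`…FarFieldCellSymm`).

* `sum_coord_mul_coord_isometry`, `sum_two_form_isometry` — the matrix of a linear isometry in the frame `e3` is
  orthogonal; the trace `Σ_i B(v_i, v_i)` of a bilinear form is frame independent;
* `moveMap p q R := x ↦ q + R(x − p)` and `IsMomentCell.image_moveMap` — moment data (ALL constants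
  `σ, δ, μ₃, μ₄`) are invariant under affine isometries (`‖B ∘ R‖ ≤ ‖B‖`); likewise
  `IsCentrallySymmetric.image_moveMap` and the structured cubic clause `cubic_clause_image_moveMap`.
  So 27Vb proves the moment data ONCE per letter on a reference cell in its own frame (file 1) and transports
  them to every site; the non-isometric distortion is handled by part 27Vb-A (`…FarFieldCellAffine`).
-/

namespace Summit.AtomisticToContinuum.Crystallization.Theorems.OverbindingBudgetAffineFarFieldCellMove

noncomputable section

open MeasureTheory
open Summit.AtomisticToContinuum.Crystallization.Theorems.OverbindingBudgetAffineFarFieldCellTaylor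
open Summit.AtomisticToContinuum.Crystallization.Theorems.OverbindingBudgetAffineFarFieldCellSymm

local notation "E3" => EuclideanSpace ℝ (Fin 3)

/-! ### Transport of cell data under affine isometries `x ↦ q + R (x - p)` -/

/-- Coordinates are inner products with the frame vectors. -/
theorem coord_eq_inner (v : E3) (j : Fin 3) : v j = inner ℝ (e3 j) v := by
  simp only [e3, EuclideanSpace.inner_single_left, map_one, one_mul]

/-- Row-orthonormality of the matrix of a linear isometry in the frame `e3`. -/
theorem sum_coord_mul_coord_isometry (R : E3 ≃ₗᵢ[ℝ] E3) (j k : Fin 3) :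
    ∑ i : Fin 3, R (e3 i) j * R (e3 i) k = if j = k then 1 else 0 := by
  set b := EuclideanSpace.basisFun (Fin 3) ℝ with hb
  have h1 : ∀ i l : Fin 3, R (e3 i) l = inner ℝ (R.symm (e3 l)) (b i) := by
    intro i l
    calc R (e3 i) l = inner ℝ (e3 l) (R (e3 i)) := coord_eq_inner _ _
      _ = inner ℝ (R (e3 i)) (e3 l) := real_inner_comm _ _
      _ = inner ℝ (e3 i) (R.symm (e3 l)) := LinearIsometryEquiv.inner_map_eq_flip _ _ _
      _ = inner ℝ (R.symm (e3 l)) (e3 i) := real_inner_comm _ _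
      _ = inner ℝ (R.symm (e3 l)) (b i) := by rw [hb, EuclideanSpace.basisFun_apply]; rfl
  have h2 : ∀ i : Fin 3, inner ℝ (R.symm (e3 k)) (b i) = inner ℝ (b i) (R.symm (e3 k)) :=
    fun i => real_inner_comm _ _
  simp_rw [h1, h2]
  rw [b.sum_inner_mul_inner, LinearIsometryEquiv.inner_map_map, ← coord_eq_inner, e3_apply]

/-- The trace `Σ_i B(v_i, v_i)` of a bilinear form does not depend on the orthonormal frame. -/
theorem sum_two_form_isometry (B : E3 [×2]→L[ℝ] ℝ) (R : E3 ≃ₗᵢ[ℝ] E3) :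
    ∑ i : Fin 3, B (fun _ => R (e3 i)) = ∑ i : Fin 3, B (fun _ => e3 i) := by
  have key : ∀ T : E3 ≃ₗᵢ[ℝ] E3,
      ∑ i : Fin 3, B (fun _ => T (e3 i)) = ∑ j : Fin 3, B ![e3 j, e3 j] := by
    intro T
    simp_rw [two_form_expand B]
    rw [Finset.sum_comm]
    refine Finset.sum_congr rfl (fun j _ => ?_)
    rw [Finset.sum_comm]
    have h : ∀ k : Fin 3, ∑ i : Fin 3, T (e3 i) j * T (e3 i) k * B ![e3 j, e3 k]
        = (if j = k then 1 else 0) * B ![e3 j, e3 k] := by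
      intro k
      rw [← Finset.sum_mul, sum_coord_mul_coord_isometry]
    simp_rw [h]
    simp [Finset.sum_ite_eq, ite_mul]
  rw [key R]
  simp_rw [two_form_diag]

/-- support: the affine isometry `x ↦ q + R (x - p)` carrying a cell at `p` to a congruent cell at `q`. -/
def moveMap (p q : E3) (R : E3 ≃ₗᵢ[ℝ] E3) : E3 → E3 := fun x => q + R (x - p)

/-- `moveMap` is continuous. -/
theorem continuous_moveMap (p q : E3) (R : E3 ≃ₗᵢ[ℝ] E3) : Continuous (moveMap p q R) :=
  continuous_const.add (R.continuous.comp (continuous_id.sub continuous_const))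

/-- `moveMap` preserves Lebesgue measure. -/
theorem measurePreserving_moveMap (p q : E3) (R : E3 ≃ₗᵢ[ℝ] E3) :
    MeasurePreserving (moveMap p q R) volume volume :=
  (measurePreserving_add_left volume q).comp
    (R.measurePreserving.comp (measurePreserving_sub_right volume p))

/-- `moveMap` is a measurable embedding. -/
theorem measurableEmbedding_moveMap (p q : E3) (R : E3 ≃ₗᵢ[ℝ] E3) :
    MeasurableEmbedding (moveMap p q R) :=
  (measurableEmbedding_addLeft q).comp
    (R.toMeasurableEquiv.measurableEmbedding.comp (measurableEmbedding_subRight p))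

/-- `moveMap p q R x - q = R (x - p)`. -/
theorem moveMap_sub (p q : E3) (R : E3 ≃ₗᵢ[ℝ] E3) (x : E3) : moveMap p q R x - q = R (x - p) := by
  simp [moveMap]

/-- Change of variables onto the moved cell. -/
theorem setIntegral_image_moveMap (p q : E3) (R : E3 ≃ₗᵢ[ℝ] E3) (K : Set E3)
    {F : Type*} [NormedAddCommGroup F] [NormedSpace ℝ F] (g : E3 → F) :
    ∫ y in moveMap p q R '' K, g y = ∫ x in K, g (moveMap p q R x) :=
  (measurePreserving_moveMap p q R).setIntegral_image_emb (measurableEmbedding_moveMap p q R) g K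

/-- The moved cell has the same volume. -/
theorem volume_image_moveMap (p q : E3) (R : E3 ≃ₗᵢ[ℝ] E3) (K : Set E3) :
    volume (moveMap p q R '' K) = volume K := by
  have h := (measurePreserving_moveMap p q R).measure_preimage_emb
    (measurableEmbedding_moveMap p q R) (moveMap p q R '' K)
  rw [(measurableEmbedding_moveMap p q R).injective.preimage_image] at h
  exact h.symm

/-- The moved cell is star-shaped about its new centre. -/
theorem starConvex_image_moveMap {K : Set E3} {p : E3} (hKs : StarConvex ℝ p K) (q : E3)
    (R : E3 ≃ₗᵢ[ℝ] E3) : StarConvex ℝ q (moveMap p q R '' K) := by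
  rintro _ ⟨x, hx, rfl⟩ a b ha hb hab
  refine ⟨a • p + b • x, hKs hx ha hb hab, ?_⟩
  simp only [moveMap]
  have h1 : a • p + b • x - p = b • (x - p) := by
    calc a • p + b • x - p = a • p + b • x - (a + b) • p := by rw [hab, one_smul]
      _ = b • (x - p) := by rw [add_smul, smul_sub]; abel
  rw [h1, LinearIsometryEquiv.map_smul]
  calc q + b • R (x - p) = (a + b) • q + b • R (x - p) := by rw [hab, one_smul]
    _ = a • q + b • (q + R (x - p)) := by rw [add_smul, smul_add]; abel

/-- **Transport.**  Moment data are invariant under affine isometries: if `K` is a moment cell at `p`,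
then `q + R(K - p)` is a moment cell at `q` with the same constants. -/
theorem IsMomentCell.image_moveMap {K : Set E3} {p : E3} {σ δ μ₃ μ₄ : ℝ}
    (hK : IsMomentCell K p σ δ μ₃ μ₄) (q : E3) (R : E3 ≃ₗᵢ[ℝ] E3) :
    IsMomentCell (moveMap p q R '' K) q σ δ μ₃ μ₄ := by
  obtain ⟨hKc, hKs, hpK, hδ, hM1, hM2, hM3, hM4⟩ := hK
  have hvol : (volume (moveMap p q R '' K)).toReal = (volume K).toReal := by
    rw [volume_image_moveMap]
  refine ⟨hKc.image (continuous_moveMap p q R), starConvex_image_moveMap hKs q R,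
    ⟨p, hpK, by simp [moveMap]⟩, hδ, ?_, ?_, ?_, ?_⟩
  · rw [setIntegral_image_moveMap]
    simp only [moveMap_sub]
    have h := R.toLinearIsometry.integral_comp_comm (μ := volume.restrict K) (fun x : E3 => x - p)
    simp only [LinearIsometryEquiv.coe_toLinearIsometry] at h
    rw [h, hM1, map_zero]
  · intro B
    set L : E3 →L[ℝ] E3 := R.toLinearIsometry.toContinuousLinearMap with hL
    set B' : E3 [×2]→L[ℝ] ℝ := B.compContinuousLinearMap (fun _ => L) with hB'
    have hB'ap : ∀ m : Fin 2 → E3, B' m = B (fun i => R (m i)) := fun m => by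
      simp [hB', hL, ContinuousMultilinearMap.compContinuousLinearMap_apply]
    rw [setIntegral_image_moveMap, hvol]
    simp only [moveMap_sub]
    have e1 : (fun x : E3 => B (fun _ => R (x - p))) = fun x => B' (fun _ => x - p) := by
      funext x; rw [hB'ap]
    have e2 : ∑ i : Fin 3, B (fun _ => e3 i) = ∑ i : Fin 3, B' (fun _ => e3 i) := by
      simp_rw [hB'ap]
      exact (sum_two_form_isometry B R).symm
    rw [e1, e2]
    have hn : ‖B'‖ ≤ ‖B‖ :=
      calc ‖B'‖ ≤ ‖B‖ * ∏ _i : Fin 2, ‖L‖ := B.norm_compContinuousLinearMap_le _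
        _ ≤ ‖B‖ * 1 := by
            apply mul_le_mul_of_nonneg_left _ (norm_nonneg _)
            exact Finset.prod_le_one (fun _ _ => norm_nonneg _)
              (fun _ _ => R.toLinearIsometry.norm_toContinuousLinearMap_le)
        _ = ‖B‖ := mul_one _
    calc _ ≤ δ * (volume K).toReal * ‖B'‖ := hM2 B'
      _ ≤ δ * (volume K).toReal * ‖B‖ :=
          mul_le_mul_of_nonneg_left hn (mul_nonneg hδ ENNReal.toReal_nonneg)
  · rw [setIntegral_image_moveMap, hvol]
    simp only [moveMap_sub, LinearIsometryEquiv.norm_map]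
    exact hM3
  · rw [setIntegral_image_moveMap, hvol]
    simp only [moveMap_sub, LinearIsometryEquiv.norm_map]
    exact hM4

/-- Central symmetry is transported too. -/
theorem IsCentrallySymmetric.image_moveMap {K : Set E3} {p : E3} (hS : IsCentrallySymmetric K p)
    (q : E3) (R : E3 ≃ₗᵢ[ℝ] E3) : IsCentrallySymmetric (moveMap p q R '' K) q := by
  rintro _ ⟨x, hx, rfl⟩
  refine ⟨(2 : ℝ) • p - x, hS x hx, ?_⟩
  simp only [moveMap]
  have h1 : (2 : ℝ) • p - x - p = -(x - p) := by
    simp only [two_smul]; abel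
  rw [h1, map_neg, two_smul]
  abel

/-- A structured cubic clause (`cell_taylor_tau`) is transported as well. -/
theorem cubic_clause_image_moveMap {K : Set E3} {p : E3} {τ : ℝ}
    (hτ : ∀ B : E3 [×3]→L[ℝ] ℝ, |∫ x in K, B (fun _ => x - p)| ≤ τ * (volume K).toReal * ‖B‖)
    (hτ0 : 0 ≤ τ) (q : E3) (R : E3 ≃ₗᵢ[ℝ] E3) (B : E3 [×3]→L[ℝ] ℝ) :
    |∫ y in moveMap p q R '' K, B (fun _ => y - q)|
      ≤ τ * (volume (moveMap p q R '' K)).toReal * ‖B‖ := by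
  set L : E3 →L[ℝ] E3 := R.toLinearIsometry.toContinuousLinearMap with hL
  set B' : E3 [×3]→L[ℝ] ℝ := B.compContinuousLinearMap (fun _ => L) with hB'
  have hB'ap : ∀ m : Fin 3 → E3, B' m = B (fun i => R (m i)) := fun m => by
    simp [hB', hL, ContinuousMultilinearMap.compContinuousLinearMap_apply]
  rw [setIntegral_image_moveMap, volume_image_moveMap]
  simp only [moveMap_sub]
  have e1 : (fun x : E3 => B (fun _ => R (x - p))) = fun x => B' (fun _ => x - p) := by
    funext x; rw [hB'ap]
  rw [e1]
  have hn : ‖B'‖ ≤ ‖B‖ :=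
    calc ‖B'‖ ≤ ‖B‖ * ∏ _i : Fin 3, ‖L‖ := B.norm_compContinuousLinearMap_le _
      _ ≤ ‖B‖ * 1 := by
          apply mul_le_mul_of_nonneg_left _ (norm_nonneg _)
          exact Finset.prod_le_one (fun _ _ => norm_nonneg _)
            (fun _ _ => R.toLinearIsometry.norm_toContinuousLinearMap_le)
      _ = ‖B‖ := mul_one _
  calc _ ≤ τ * (volume K).toReal * ‖B'‖ := hτ B'
    _ ≤ τ * (volume K).toReal * ‖B‖ :=
        mul_le_mul_of_nonneg_left hn (mul_nonneg hτ0 ENNReal.toReal_nonneg)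

end

end Summit.AtomisticToContinuum.Crystallization.Theorems.OverbindingBudgetAffineFarFieldCellMove
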